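import Summits.QuantumFields.BalabanUV.T4Continuum.Spine.NE9.SummableMemory
import Summits.QuantumFields.BalabanUV.Beta.EriceRemainderEnclosureHistoryRenewalStretched

/-!
# T⁴ programme, spine estimate NE9 (node U3, history side) — FADING MEMORY IS A CONSEQUENCE OF THE TOWER η-RATE:
# NE5 for ALL consecutive run lengths («tower-NE5», UV-insensitivity at fixed arguments) makes the scale-`m` term's OSCILLATION
# in its couplings of age `> A` at most `2C₅θ^A∕(1−θ)`; with ANY coordinatewise Lipschitz moduli of at most geometric GROWTH
# (no decay, no clause N2) node U3 → U6 then closes by a young∕old split — census item of cell `pub-balaban-gaps`, seat ne9 (gen 3),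
# answering [NE4-G3-ROW v2.5] (4) «is the tower typable on your carriers? If yes, NE9's decay half is not an independent estimate»

Cell `pub-balaban-gaps` (YM blitz G2, seat ne9, unit `pub-balaban-gaps-ne9-g3`; record `run/shared/lean/pub/pub-balaban-gaps/ne/NE9.md` §5 row
C24).  Summits-side bookkeeping; by-name inputs: gen 2's `SummableMemory.summable_delta_of_scaleProfile` (node U6's socket), `T4OutputRate.{NE5,
Window}`, and (E33d)'s `EriceRemainderEnclosureHistoryRenewalContinuum.summable_succ_mul_pow_sqrt`.  No definition is made: the TOWER is a bare
sequence `F : ℕ → (ℕ → ℝ) → ℝ` — `F m g` = the term of the run in which the FIXED physical localization domain `X` has scale index `m` (it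
depends on the `m` couplings `g 0, …, g (m−1)`, `g 0` the bare one), at that run's transported background, decay factor `e^{−κd(X)}` stripped.

WHY (prompted by ne4's (R29) for the β-side).  `T4OutputRate.NE5 EA EB W κ θ C₅` compares the scale-`j` terms of two runs whose cutoffs
differ by ONE step AT FIXED ARGUMENTS; with run B's unpaired bare coupling `b` as a parameter (`∀ b, NE5 EA (EB b)`, as node U2's read-out
uses it): prepending a bare coupling and refining the lattice once changes the term by `≤ C₅θ^j`, so the term OSCILLATES in its OLDEST
coupling by `≤ 2C₅θ^j` (`osc_unpaired_of_ne5`).  The spine assumes NE5 for EVERY consecutive pair of run lengths (node U6 sums over the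
cutoff); read at one physical domain this is the TOWER RATE `|F (m+1) g − F m (g ∘ succ)| ≤ C₅θ^m` (`hT`), and peeling the `a` oldest couplings
gives (§1, `osc_le_of_towerRate`): two histories that AGREE at all indices `≥ a` have `|F (m+a) g − F (m+a) g'| ≤ 2C₅θ^m∕(1−θ)` — couplings
MORE THAN `m` SCALES OLDER than the term matter `O(θ^m)`: FADING MEMORY IN OSCILLATION FORM, with NO Lipschitz structure and NO recursion.
Consequences, all kernel-checked here on the abstract tower:
* §2 `split_bound`: with ANY history moduli `Λ` (`|F m g − F m g'| ≤ Σ_{i<m} Λ m i·|g_i − g'_i|` on a box window — `T4OutputRate.NE9`'s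
  shape with the decay stripped), splitting a pair of histories at index `a ≤ m` into an old block (oscillation) and a young block
  (moduli): `|F m g − F m g'| ≤ 2C₅θ^{m−a}∕(1−θ) + Σ_{i ∈ [a,m)} Λ m i·|g_i − g'_i|`.
* §3 BOUNDED MODULI (`0 ≤ Λ m i ≤ C₉` — this INCLUDES the record's `FadingMemory C₉ ω`, `ω ≤ 1`, AND the CONSTANT moduli of census row
  C5, which ALONE are insufficient, `T4OutputRate.historySum_const`): against a discrepancy profile `d` with FINITE FIRST MOMENT
  `Σ_i (i+1)·d_i < ∞` (node U2's `C·θ′^i` ✓; (E33g)'s `L·ρ^⌊√i⌋` ✓ by `summable_succ_mul_pow_sqrt`) the split at `a = m − m∕2` gives the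
  cutoff-free majorant `b_m = 2C₅θ^{m∕2}∕(1−θ) + C₉·Σ_{i ∈ [m∕2, m)} d_i` with `Σ_m b_m < ∞` (`bracket_le_of_bounded`, `summable_majorant_bounded`;
  tools `summable_comp_div`, `sum_sum_Ico_half_le`) — hence node U6's `Summable (T4CauchySum.delta E ρ inj)` for every injection under it
  (`summable_delta_of_bounded`).  NO DECAY OF THE MODULI IS USED.
* §3 GROWING MODULI (`0 ≤ Λ m i ≤ C₉·μ^{m−i}`, ANY `μ ≥ 1` — e.g. the recursion's `ℓ(ω+c)^{m−1−i}` of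
  `T4HistoryLipschitzRecursion.ne9_and_fadingMemory_of_geometricStep` WITHOUT its clause `ω + c < 1`): against node U2's GEOMETRIC profile
  `d_i ≤ D·θ′^i` and ONE integer `N ≥ 1` with `μ·θ′^{N−1} < 1` (always available when `θ′ < 1`), the split at `a = m − m∕N` gives
  `b_m = 2C₅θ^{m∕N}∕(1−θ) + C₉D·(m∕N)·(μθ′^{N−1})^{m∕N}`, summable (`bracket_le_of_growing`, `summable_majorant_growing`,
  `summable_delta_of_growing`).  So, GIVEN tower-NE5, the record's smallness clause N2 is IDLE for node U3 → U6 in the geometric U2 regime: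
  ANY finite `ω + c` will do.
* §4 the dictionary lemmas: `T4OutputRate.Window γ` is shift- and hybrid-closed (`shift_mem_window`, `mix_mem_window`); on the two-run
  carriers `∀ b ∈ ]0,γ], NE5 EA (EB b) (Window γ) κ θ C₅` IS the `a = 1` oscillation statement (`osc_unpaired_of_ne5`).  A tower of carriers
  (backgrounds∕transports indexed by run length) is typable as a structure but NOT defined here — `F` is its section at one domain.
VERDICT FOR THE ROW (answer to ne4's question (4)): YES — the tower is typable (here as the sequence `F`; as carriers, a structure indexed
by run length), and GIVEN the spine's NE5 for all consecutive run pairs the DECAY half of NE9 (`T4OutputRate.FadingMemory`) is NOT an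
independent estimate for node U3 → U6.  What the E-side owes instead, on the BOX window: in node U2's geometric regime (the record), ANY
family of coordinatewise Lipschitz moduli of at most geometric GROWTH — which `StepLipschitz` with ANY constants delivers
(`ne9_and_fadingMemory_of_geometricStep` read without `hsmall`), so clause N2 is idle there; in (E33g)'s stretched regime (no β-side
fading), BOUNDED moduli (`ω + c ≤ 1`, or constant moduli from a uniform per-coupling regularity bound of printed TYPE for the last coupling,
[Balaban1987RG1] p. 263 *"It is a C^∞-function of g_{j−1} ∈ [0, γ]"*, unprinted for the older ones exactly as NE9 is).  The classification
of NE9 is UNCHANGED in kind (WORK-bound: the moduli still need the one-step model W1) but its residual shrinks: no fading, and no renewal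
smallness in the record's regime; the memory content of NE9 is NE5's.  (The literal shape `FadingMemory` can also be DERIVED from the
oscillation form plus C^{1,1}-regularity per coupling by ne4's Landau–Kolmogorov lemma `Spine/NE4/FadingFromRate.abs_deriv_le_of_osc`
(p341794); node U3 → U6 does not need it.)  NOT covered: windows of RG trajectories (the split uses hybrid histories), and the (E33c)
K-dependent matching form.

HONEST FRAMING: bookkeeping for rung (B)+1 on a FIXED finite four-torus; real analysis on hypothesis SHAPES; tower-NE5 is the cell's estimate
NE5 (NOT PRINTED, NOT PROVED) assumed for every consecutive pair of run lengths, as node U6's sum over the cutoff already requires; NE9 NOT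
PRINTED ∕ NOT PROVED; spine PROVED 0∕9 unchanged; NOT UV stability, NOT the continuum limit, NOT infinite volume, NOT a mass gap, NOT Clay.
HONEST DEPENDENCY: continuum YM on T⁴ ⇐ BetaPertH ∧ nine spine estimates (0∕9 proved); BetaPertH ⇐ (D1) ∧ (D4) ∧ CAP+tail.

References (TYPES only): [Balaban1987RG1] = T. Bałaban, Commun. Math. Phys. **109** (1987) 249–301, Thm 1 p. 259, p. 263, p. 298.
-/

namespace Summit.QuantumFields.BalabanUV.T4Continuum.NE9.MemoryFromRate

open scoped BigOperators
open Finset Filter Topology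
open Literature.MathematicalPhysics.QuantumFieldTheory.Balaban1983to89
open Literature.MathematicalPhysics.QuantumFieldTheory.Balaban1983to89.T4OutputRate
open T4CauchySum (delta)
open Summit.QuantumFields.BalabanUV.T4Continuum.NE9.SummableMemory (summable_delta_of_scaleProfile)
open Summit.QuantumFields.BalabanUV.Beta.EriceRemainderEnclosureHistoryRenewalContinuum (summable_succ_mul_pow_sqrt)

variable {W : Set (ℕ → ℝ)} {F : ℕ → (ℕ → ℝ) → ℝ}

/-! ## §1 Oscillation fading from the tower rate -/

/-- **PEELING THE OLD COUPLINGS** (exact form).  On a shift-closed window, the tower rate `|F (m+1) g − F m (g ∘ succ)| ≤ C₅θ^m` gives,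
for two histories agreeing at all indices `≥ a`: `|F (m+a) g − F (m+a) g'| ≤ 2C₅·Σ_{t<a} θ^{m+t}` (induction on `a`: drop the oldest
coupling on both sides, `2C₅θ^{m+a}` per drop). [folklore] -/
theorem osc_le_sum_of_towerRate {C₅ θ : ℝ}
    (hW : ∀ g ∈ W, (fun i => g (i + 1)) ∈ W)
    (hT : ∀ m, ∀ g ∈ W, |F (m + 1) g - F m (fun i => g (i + 1))| ≤ C₅ * θ ^ m) :
    ∀ (a m : ℕ) (g g' : ℕ → ℝ), g ∈ W → g' ∈ W → (∀ i, a ≤ i → g i = g' i) →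
      |F (m + a) g - F (m + a) g'| ≤ 2 * C₅ * ∑ t ∈ range a, θ ^ (m + t) := by
  intro a
  induction a with
  | zero =>
    intro m g g' _ _ hagree
    have : g = g' := funext fun i => hagree i (Nat.zero_le i)
    simp [this]
  | succ a ih =>
    intro m g g' hg hg' hagree
    rw [← add_assoc, sum_range_succ]
    have h1 := hT (m + a) g hg
    have h2 := hT (m + a) g' hg'
    have h3 := ih m (fun i => g (i + 1)) (fun i => g' (i + 1)) (hW g hg) (hW g' hg')
      (fun i hi => hagree (i + 1) (by omega))
    have t1 := abs_sub_le (F (m + a + 1) g) (F (m + a) fun i => g (i + 1)) (F (m + a + 1) g')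
    have t2 := abs_sub_le (F (m + a) fun i => g (i + 1)) (F (m + a) fun i => g' (i + 1)) (F (m + a + 1) g')
    rw [abs_sub_comm] at h2
    linarith

/-- **OSCILLATION FADING FROM THE TOWER RATE.**  Shift-closed window, tower rate with `C₅ ≥ 0`, `0 ≤ θ < 1`: two admissible histories
that AGREE at every index `≥ a` (i.e. differ only in the `a` OLDEST couplings) give, `m` levels above the last drop,
`|F (m+a) g − F (m+a) g'| ≤ 2C₅θ^m∕(1−θ)` — the couplings more than `m` scales older than the term matter `O(θ^m)`, whatever the size of
their discrepancy.  This is `T4OutputRate.FadingMemory`'s content in OSCILLATION form, derived, with no moduli. [folklore] -/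
theorem osc_le_of_towerRate {C₅ θ : ℝ} (hC : 0 ≤ C₅) (hθ0 : 0 ≤ θ) (hθ1 : θ < 1)
    (hW : ∀ g ∈ W, (fun i => g (i + 1)) ∈ W)
    (hT : ∀ m, ∀ g ∈ W, |F (m + 1) g - F m (fun i => g (i + 1))| ≤ C₅ * θ ^ m)
    {a m : ℕ} {g g' : ℕ → ℝ} (hg : g ∈ W) (hg' : g' ∈ W) (hagree : ∀ i, a ≤ i → g i = g' i) :
    |F (m + a) g - F (m + a) g'| ≤ 2 * C₅ * θ ^ m / (1 - θ) := by
  have h := osc_le_sum_of_towerRate hW hT a m g g' hg hg' hagree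
  have hs : ∑ t ∈ range a, θ ^ (m + t) ≤ θ ^ m / (1 - θ) := by
    have e : ∑ t ∈ range a, θ ^ (m + t) = θ ^ m * ∑ t ∈ range a, θ ^ t := by
      rw [mul_sum]
      exact sum_congr rfl fun t _ => pow_add θ m t
    rw [e, div_eq_mul_inv]
    exact mul_le_mul_of_nonneg_left
      (sum_le_hasSum _ (fun n _ => pow_nonneg hθ0 n) (hasSum_geometric_of_lt_one hθ0 hθ1)) (pow_nonneg hθ0 m)
  calc |F (m + a) g - F (m + a) g'| ≤ 2 * C₅ * ∑ t ∈ range a, θ ^ (m + t) := h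
    _ ≤ 2 * C₅ * (θ ^ m / (1 - θ)) := mul_le_mul_of_nonneg_left hs (by positivity)
    _ = 2 * C₅ * θ ^ m / (1 - θ) := by ring

/-! ## §2 The young∕old split -/

/-- **THE SPLIT.**  Tower rate on a shift- and hybrid-closed window + ANY history moduli `Λ` in `T4OutputRate.NE9`'s (decay-stripped) shape
`|F m g − F m g'| ≤ Σ_{i<m} Λ m i·|g_i − g'_i|`: for `a ≤ m` and two admissible histories,
`|F m g − F m g'| ≤ 2C₅θ^{m−a}∕(1−θ) + Σ_{i ∈ [a, m)} Λ m i·|g_i − g'_i|` — pass through the hybrid history (old block of `g'`, young block of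
`g`): the old block costs the oscillation bound, the young block the moduli. [folklore] -/
theorem split_bound {C₅ θ : ℝ} {Λ : ℕ → ℕ → ℝ} (hC : 0 ≤ C₅) (hθ0 : 0 ≤ θ) (hθ1 : θ < 1)
    (hW : ∀ g ∈ W, (fun i => g (i + 1)) ∈ W)
    (hWmix : ∀ g ∈ W, ∀ g' ∈ W, ∀ a : ℕ, (fun i => if i < a then g' i else g i) ∈ W)
    (hT : ∀ m, ∀ g ∈ W, |F (m + 1) g - F m (fun i => g (i + 1))| ≤ C₅ * θ ^ m)
    (hL : ∀ m, ∀ g ∈ W, ∀ g' ∈ W, |F m g - F m g'| ≤ ∑ i ∈ range m, Λ m i * |g i - g' i|)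
    {a m : ℕ} (ham : a ≤ m) {g g' : ℕ → ℝ} (hg : g ∈ W) (hg' : g' ∈ W) :
    |F m g - F m g'| ≤ 2 * C₅ * θ ^ (m - a) / (1 - θ) + ∑ i ∈ Ico a m, Λ m i * |g i - g' i| := by
  obtain ⟨k, rfl⟩ := Nat.exists_eq_add_of_le ham
  rw [Nat.add_sub_cancel_left]
  set h : ℕ → ℝ := fun i => if i < a then g' i else g i with hh
  have hhW : h ∈ W := hWmix g hg g' hg' a
  have h1 : |F (a + k) g - F (a + k) h| ≤ 2 * C₅ * θ ^ k / (1 - θ) := by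
    rw [add_comm a k]
    exact osc_le_of_towerRate hC hθ0 hθ1 hW hT hg hhW fun i hi => by simp [hh, not_lt.mpr hi]
  have h2 : |F (a + k) h - F (a + k) g'| ≤ ∑ i ∈ Ico a (a + k), Λ (a + k) i * |g i - g' i| := by
    refine (hL (a + k) h hhW g' hg').trans (le_of_eq ?_)
    rw [range_eq_Ico, ← sum_Ico_consecutive _ (Nat.zero_le a) (Nat.le_add_right a k),
      sum_eq_zero (fun i hi => ?_), zero_add]
    · exact sum_congr rfl fun i hi => by
        have hia : a ≤ i := (mem_Ico.mp hi).1
        simp [hh, not_lt.mpr hia]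
    · have hia : i < a := (mem_Ico.mp hi).2
      simp [hh, hia]
  calc |F (a + k) g - F (a + k) g'| ≤ |F (a + k) g - F (a + k) h| + |F (a + k) h - F (a + k) g'| := abs_sub_le _ _ _
    _ ≤ _ := add_le_add h1 h2

/-! ## §3 Summable majorants: bounded moduli (first-moment discrepancies) and growing moduli (geometric discrepancies) -/

/-- Block summation along `m ↦ m ∕ N`: `Σ_{m < N·K} φ(m∕N) = N·Σ_{k<K} φ(k)` (`0 < N`). [folklore] -/
theorem sum_range_mul_comp_div (φ : ℕ → ℝ) {N : ℕ} (hN : 0 < N) (K : ℕ) :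
    ∑ m ∈ range (N * K), φ (m / N) = N * ∑ k ∈ range K, φ k := by
  induction K with
  | zero => simp
  | succ K ih =>
    rw [Nat.mul_succ, sum_range_add, ih, sum_range_succ, mul_add]
    congr 1
    have hc : ∀ r ∈ range N, φ ((N * K + r) / N) = φ K := fun r hr => by
      rw [Nat.mul_add_div hN, Nat.div_eq_of_lt (mem_range.mp hr), add_zero]
    rw [sum_congr rfl hc, sum_const, card_range, nsmul_eq_mul]

/-- `N`-to-one composition preserves summability: `φ ≥ 0` summable, `0 < N` ⇒ `m ↦ φ(m∕N)` summable (partial sums `≤ N·Σφ`). [folklore] -/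
theorem summable_comp_div {φ : ℕ → ℝ} (hφ0 : ∀ k, 0 ≤ φ k) (hφ : Summable φ) {N : ℕ} (hN : 0 < N) :
    Summable (fun m : ℕ => φ (m / N)) := by
  refine summable_of_sum_range_le (c := N * ∑' k, φ k) (fun m => hφ0 _) fun M => ?_
  calc ∑ m ∈ range M, φ (m / N) ≤ ∑ m ∈ range (N * (M / N + 1)), φ (m / N) :=
        sum_le_sum_of_subset_of_nonneg (range_mono (Nat.lt_mul_div_succ M hN).le) fun m _ _ => hφ0 _
    _ = N * ∑ k ∈ range (M / N + 1), φ k := sum_range_mul_comp_div φ hN _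
    _ ≤ N * ∑' k, φ k :=
        mul_le_mul_of_nonneg_left (sum_le_hasSum _ (fun k _ => hφ0 k) hφ.hasSum) (Nat.cast_nonneg N)

/-- FINITE FUBINI FOR THE YOUNG HALVES: for `d ≥ 0`, `Σ_{m<M} Σ_{i ∈ [m∕2, m)} d_i ≤ Σ_{i<M} (i+1)·d_i` (an index `i` is young for at most
the `i + 1` levels `m ∈ (i, 2i+1]`). [folklore] -/
theorem sum_sum_Ico_half_le {d : ℕ → ℝ} (hd0 : ∀ i, 0 ≤ d i) (M : ℕ) :
    ∑ m ∈ range M, ∑ i ∈ Ico (m / 2) m, d i ≤ ∑ i ∈ range M, ((i : ℝ) + 1) * d i := by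
  have hswap : ∑ m ∈ range M, ∑ i ∈ Ico (m / 2) m, d i =
      ∑ i ∈ range M, ∑ m ∈ (range M).filter (fun m => m / 2 ≤ i ∧ i < m), d i := by
    refine sum_comm' fun m i => ?_
    simp only [mem_range, mem_Ico, mem_filter]
    omega
  rw [hswap]
  refine sum_le_sum fun i _ => ?_
  rw [sum_const, nsmul_eq_mul]
  refine mul_le_mul_of_nonneg_right ?_ (hd0 i)
  have hsub : (range M).filter (fun m => m / 2 ≤ i ∧ i < m) ⊆ Icc (i + 1) (2 * i + 1) := by
    intro m hm
    simp only [mem_filter, mem_range] at hm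
    simp only [mem_Icc]
    omega
  have hcard := card_le_card hsub
  rw [Nat.card_Icc] at hcard
  have : (((range M).filter (fun m => m / 2 ≤ i ∧ i < m)).card : ℝ) ≤ ((2 * i + 1 + 1 - (i + 1) : ℕ) : ℝ) := by
    exact_mod_cast hcard
  refine this.trans (le_of_eq ?_)
  rw [show 2 * i + 1 + 1 - (i + 1) = i + 1 by omega]
  push_cast
  ring

/-- **BOUNDED MODULI — POINTWISE.**  Tower rate + moduli with `0 ≤ Λ m i ≤ C₉` (`i < m`; this includes `FadingMemory C₉ ω`, `ω ≤ 1`, AND the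
constant moduli of census row C5) + a discrepancy profile `|g_i − g'_i| ≤ d_i`: the split at `a = m − m∕2` gives the cutoff-free bound
`|F m g − F m g'| ≤ 2C₅θ^{m∕2}∕(1−θ) + C₉·Σ_{i ∈ [m∕2, m)} d_i`. [folklore] -/
theorem bracket_le_of_bounded {C₅ θ C₉ : ℝ} {Λ : ℕ → ℕ → ℝ} {d : ℕ → ℝ} (hC : 0 ≤ C₅) (hθ0 : 0 ≤ θ) (hθ1 : θ < 1)
    (hW : ∀ g ∈ W, (fun i => g (i + 1)) ∈ W)
    (hWmix : ∀ g ∈ W, ∀ g' ∈ W, ∀ a : ℕ, (fun i => if i < a then g' i else g i) ∈ W)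
    (hT : ∀ m, ∀ g ∈ W, |F (m + 1) g - F m (fun i => g (i + 1))| ≤ C₅ * θ ^ m)
    (hL : ∀ m, ∀ g ∈ W, ∀ g' ∈ W, |F m g - F m g'| ≤ ∑ i ∈ range m, Λ m i * |g i - g' i|)
    (hΛ : ∀ m i, i < m → 0 ≤ Λ m i ∧ Λ m i ≤ C₉)
    {g g' : ℕ → ℝ} (hg : g ∈ W) (hg' : g' ∈ W) (hd : ∀ i, |g i - g' i| ≤ d i) (m : ℕ) :
    |F m g - F m g'| ≤ 2 * C₅ * θ ^ (m / 2) / (1 - θ) + C₉ * ∑ i ∈ Ico (m / 2) m, d i := by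
  have hsplit := split_bound hC hθ0 hθ1 hW hWmix hT hL (Nat.sub_le m (m / 2)) hg hg' (a := m - m / 2) (m := m)
  rw [Nat.sub_sub_self (Nat.div_le_self m 2)] at hsplit
  refine hsplit.trans (add_le_add le_rfl ?_)
  have hd0 : ∀ i, 0 ≤ d i := fun i => (abs_nonneg _).trans (hd i)
  calc ∑ i ∈ Ico (m - m / 2) m, Λ m i * |g i - g' i| ≤ ∑ i ∈ Ico (m - m / 2) m, C₉ * d i :=
        sum_le_sum fun i hi => by
          have him : i < m := (mem_Ico.mp hi).2
          exact mul_le_mul (hΛ m i him).2 (hd i) (abs_nonneg _) ((hΛ m i him).1.trans (hΛ m i him).2)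
    _ ≤ ∑ i ∈ Ico (m / 2) m, C₉ * d i := by
        refine sum_le_sum_of_subset_of_nonneg (fun i hi => ?_) fun i _ _ =>
          mul_nonneg ((hΛ 1 0 Nat.one_pos).1.trans (hΛ 1 0 Nat.one_pos).2) (hd0 i)
        simp only [mem_Ico] at hi ⊢
        omega
    _ = C₉ * ∑ i ∈ Ico (m / 2) m, d i := by rw [mul_sum]

/-- **BOUNDED MODULI — THE MAJORANT IS ℓ¹** once the discrepancy profile has a finite FIRST MOMENT (`d ≥ 0`, `Σ_i (i+1)·d_i < ∞`):
`Σ_m [2C₅θ^{m∕2}∕(1−θ) + C₉·Σ_{i ∈ [m∕2, m)} d_i] < ∞` (`C₅, C₉ ≥ 0`, `0 ≤ θ < 1`). [folklore] -/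
theorem summable_majorant_bounded {C₅ θ C₉ : ℝ} {d : ℕ → ℝ} (hθ0 : 0 ≤ θ) (hθ1 : θ < 1)
    (hd0 : ∀ i, 0 ≤ d i) (hd1 : Summable (fun i : ℕ => ((i : ℝ) + 1) * d i)) :
    Summable (fun m : ℕ => 2 * C₅ * θ ^ (m / 2) / (1 - θ) + C₉ * ∑ i ∈ Ico (m / 2) m, d i) := by
  refine Summable.add ?_ ?_
  · have h := summable_comp_div (φ := fun k : ℕ => θ ^ k) (fun k => pow_nonneg hθ0 k)
      (summable_geometric_of_lt_one hθ0 hθ1) (N := 2) (by norm_num)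
    refine (h.mul_left (2 * C₅ / (1 - θ))).congr fun m => ?_
    show 2 * C₅ / (1 - θ) * θ ^ (m / 2) = _
    ring
  · refine Summable.mul_left C₉ ?_
    refine summable_of_sum_range_le (c := ∑' i : ℕ, ((i : ℝ) + 1) * d i)
      (fun m => sum_nonneg fun i _ => hd0 i) fun M => ?_
    exact (sum_sum_Ico_half_le hd0 M).trans
      (sum_le_hasSum _ (fun i _ => mul_nonneg (by positivity) (hd0 i)) hd1.hasSum)

/-- **BOUNDED MODULI ⇒ NODE U6.**  Under the hypotheses of `summable_majorant_bounded`, every injection dominated by the majorant —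
`0 ≤ inj K j ≤ 2C₅θ^{j∕2}∕(1−θ) + C₉·Σ_{i ∈ [j∕2, j)} d_i` for `j ≤ K`, which `bracket_le_of_bounded` delivers for node U3's coupling bracket of
EVERY tower obeying the binders — has `Summable (T4CauchySum.delta E ρ inj)` (`0 ≤ E`, `0 ≤ ρ < 1`; gen 2's
`summable_delta_of_scaleProfile` BY NAME).  NO decay of the history moduli enters. [folklore] -/
theorem summable_delta_of_bounded {C₅ θ C₉ : ℝ} {d : ℕ → ℝ} (hC : 0 ≤ C₅) (hθ0 : 0 ≤ θ) (hθ1 : θ < 1) (hC9 : 0 ≤ C₉)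
    (hd0 : ∀ i, 0 ≤ d i) (hd1 : Summable (fun i : ℕ => ((i : ℝ) + 1) * d i))
    {E ρ : ℝ} (hE : 0 ≤ E) (hρ : 0 ≤ ρ) (hρ1 : ρ < 1) {inj : ℕ → ℕ → ℝ}
    (hinj : ∀ K j : ℕ, j ≤ K → 0 ≤ inj K j ∧
      inj K j ≤ 2 * C₅ * θ ^ (j / 2) / (1 - θ) + C₉ * ∑ i ∈ Ico (j / 2) j, d i) :
    Summable (delta E ρ inj) :=
  summable_delta_of_scaleProfile hE hρ hρ1
    (fun j => add_nonneg
      (div_nonneg (mul_nonneg (mul_nonneg (by norm_num) hC) (pow_nonneg hθ0 _)) (by linarith))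
      (mul_nonneg hC9 (sum_nonneg fun i _ => hd0 i)))
    (summable_majorant_bounded hθ0 hθ1 hd0 hd1) hinj

/-- Both discrepancy profiles of the cell have a finite first moment: node U2's geometric `C·θ′^i` (record, β-side `FadingMemory`) and
(E33g)'s K-uniform stretched `L·ρ^⌊√i⌋` (NO β-side `FadingMemory`; `summable_succ_mul_pow_sqrt` BY NAME). [folklore] -/
theorem firstMoment_profiles {Cθ θ' L ρ₂ : ℝ} (hθ'0 : 0 ≤ θ') (hθ'1 : θ' < 1) (hρ₂0 : 0 ≤ ρ₂) (hρ₂1 : ρ₂ < 1) :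
    Summable (fun i : ℕ => ((i : ℝ) + 1) * (Cθ * θ' ^ i)) ∧
      Summable (fun i : ℕ => ((i : ℝ) + 1) * (L * ρ₂ ^ Nat.sqrt i)) := by
  constructor
  · have h := (T4CauchySum.summable_succ_pow_mul_geometric hθ'0 hθ'1 1).mul_left Cθ
    refine h.congr fun i => ?_
    ring
  · have h := (summable_succ_mul_pow_sqrt hρ₂0 hρ₂1).mul_left L
    refine h.congr fun i => ?_
    ring
/-- **GROWING MODULI — POINTWISE.**  Tower rate + moduli of at most GEOMETRIC GROWTH `0 ≤ Λ m i ≤ C₉·μ^{m−i}` (`i < m`, ANY `μ ≥ 1`; e.g.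
the recursion's `ℓ(ω+c)^{m−1−i}` with NO smallness on `ω + c`) + node U2's geometric discrepancy `|g_i − g'_i| ≤ D·θ′^i` (`0 ≤ θ′ ≤ 1`)
+ an integer `N ≥ 1`: the split at `a = m − m∕N` gives `|F m g − F m g'| ≤ 2C₅θ^{m∕N}∕(1−θ) + C₉D·(m∕N)·(μθ′^{N−1})^{m∕N}`. [folklore] -/
theorem bracket_le_of_growing {C₅ θ C₉ μ D θ' : ℝ} {Λ : ℕ → ℕ → ℝ} (hC : 0 ≤ C₅) (hθ0 : 0 ≤ θ) (hθ1 : θ < 1)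
    (hμ : 1 ≤ μ) (hD : 0 ≤ D) (hθ'0 : 0 ≤ θ') (hθ'1 : θ' ≤ 1)
    (hW : ∀ g ∈ W, (fun i => g (i + 1)) ∈ W)
    (hWmix : ∀ g ∈ W, ∀ g' ∈ W, ∀ a : ℕ, (fun i => if i < a then g' i else g i) ∈ W)
    (hT : ∀ m, ∀ g ∈ W, |F (m + 1) g - F m (fun i => g (i + 1))| ≤ C₅ * θ ^ m)
    (hL : ∀ m, ∀ g ∈ W, ∀ g' ∈ W, |F m g - F m g'| ≤ ∑ i ∈ range m, Λ m i * |g i - g' i|)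
    (hΛ : ∀ m i, i < m → 0 ≤ Λ m i ∧ Λ m i ≤ C₉ * μ ^ (m - i))
    {g g' : ℕ → ℝ} (hg : g ∈ W) (hg' : g' ∈ W) (hd : ∀ i, |g i - g' i| ≤ D * θ' ^ i) {N : ℕ} (hN : 1 ≤ N) (m : ℕ) :
    |F m g - F m g'| ≤
      2 * C₅ * θ ^ (m / N) / (1 - θ) + C₉ * D * (m / N : ℕ) * (μ * θ' ^ (N - 1)) ^ (m / N) := by
  have hMle : m / N ≤ m := Nat.div_le_self m N
  have hsplit := split_bound hC hθ0 hθ1 hW hWmix hT hL (Nat.sub_le m (m / N)) hg hg'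
  rw [Nat.sub_sub_self hMle] at hsplit
  refine hsplit.trans (add_le_add le_rfl ?_)
  have hC9 : 0 ≤ C₉ := by
    have h10 := hΛ 1 0 Nat.one_pos
    have hμpos : 0 < μ ^ (1 - 0) := pow_pos (by linarith) _
    have h0 : 0 * μ ^ (1 - 0) ≤ C₉ * μ ^ (1 - 0) := by
      rw [zero_mul]
      exact h10.1.trans h10.2
    exact le_of_mul_le_mul_right h0 hμpos
  have hμ0 : 0 ≤ μ := by linarith
  have hNM : N * (m / N) ≤ m := Nat.mul_div_le m N
  set M := m / N with hM
  -- each young term is ≤ C₉ μ^M · D θ'^{m − M}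
  have hterm : ∀ i ∈ Ico (m - M) m, Λ m i * |g i - g' i| ≤ C₉ * μ ^ M * (D * θ' ^ (m - M)) := by
    intro i hi
    obtain ⟨hi1, hi2⟩ := mem_Ico.mp hi
    have hΛi := hΛ m i hi2
    have hpow1 : μ ^ (m - i) ≤ μ ^ M := pow_le_pow_right₀ hμ (by omega)
    have hpow2 : θ' ^ i ≤ θ' ^ (m - M) := pow_le_pow_of_le_one hθ'0 hθ'1 hi1
    calc Λ m i * |g i - g' i| ≤ (C₉ * μ ^ (m - i)) * (D * θ' ^ i) :=
          mul_le_mul hΛi.2 (hd i) (abs_nonneg _) (hΛi.1.trans hΛi.2)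
      _ ≤ (C₉ * μ ^ M) * (D * θ' ^ (m - M)) :=
          mul_le_mul (mul_le_mul_of_nonneg_left hpow1 hC9) (mul_le_mul_of_nonneg_left hpow2 hD)
            (by positivity) (by positivity)
  -- the exponent bookkeeping: (N-1)·M ≤ m − M, so θ'^{m − M} ≤ θ'^{(N-1)M}
  have hexp : (N - 1) * M ≤ m - M := by
    have h2 : (N - 1) * M + M = N * M := by
      rw [← Nat.succ_mul, Nat.succ_eq_add_one, Nat.sub_add_cancel hN]
    rw [← h2] at hNM
    exact Nat.le_sub_of_add_le hNM
  have hpow3 : θ' ^ (m - M) ≤ θ' ^ ((N - 1) * M) := pow_le_pow_of_le_one hθ'0 hθ'1 hexp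
  calc ∑ i ∈ Ico (m - M) m, Λ m i * |g i - g' i|
      ≤ ∑ i ∈ Ico (m - M) m, C₉ * μ ^ M * (D * θ' ^ (m - M)) := sum_le_sum hterm
    _ = (M : ℝ) * (C₉ * μ ^ M * (D * θ' ^ (m - M))) := by
        rw [sum_const, Nat.card_Ico, Nat.sub_sub_self hMle, nsmul_eq_mul]
    _ ≤ (M : ℝ) * (C₉ * μ ^ M * (D * θ' ^ ((N - 1) * M))) := by
        refine mul_le_mul_of_nonneg_left ?_ (Nat.cast_nonneg _)
        exact mul_le_mul_of_nonneg_left (mul_le_mul_of_nonneg_left hpow3 hD) (by positivity)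
    _ = C₉ * D * (M : ℝ) * (μ * θ' ^ (N - 1)) ^ M := by
        rw [mul_pow, ← pow_mul]
        ring

/-- **GROWING MODULI — THE MAJORANT IS ℓ¹** as soon as `q = μ·θ′^{N−1} < 1` for the chosen `N ≥ 1` (for `θ′ < 1` such an `N` ALWAYS exists,
whatever the growth rate `μ`): `Σ_m [2C₅θ^{m∕N}∕(1−θ) + C₉D·(m∕N)·q^{m∕N}] < ∞`. [folklore] -/
theorem summable_majorant_growing {C₅ θ C₉ D q : ℝ} (hθ0 : 0 ≤ θ) (hθ1 : θ < 1)
    (hq0 : 0 ≤ q) (hq1 : q < 1) {N : ℕ} (hN : 1 ≤ N) :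
    Summable (fun m : ℕ => 2 * C₅ * θ ^ (m / N) / (1 - θ) + C₉ * D * (m / N : ℕ) * q ^ (m / N)) := by
  have hNpos : 0 < N := hN
  refine Summable.add ?_ ?_
  · have h := summable_comp_div (φ := fun k : ℕ => θ ^ k) (fun k => pow_nonneg hθ0 k)
      (summable_geometric_of_lt_one hθ0 hθ1) hNpos
    refine (h.mul_left (2 * C₅ / (1 - θ))).congr fun m => ?_
    show 2 * C₅ / (1 - θ) * θ ^ (m / N) = _
    ring
  · have hφ : Summable (fun k : ℕ => (k : ℝ) * q ^ k) := by
      simpa using summable_pow_mul_geometric_of_norm_lt_one 1 (by rwa [Real.norm_of_nonneg hq0] : ‖q‖ < 1)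
    have h := summable_comp_div (φ := fun k : ℕ => (k : ℝ) * q ^ k)
      (fun k => mul_nonneg (Nat.cast_nonneg k) (pow_nonneg hq0 k)) hφ hNpos
    refine (h.mul_left (C₉ * D)).congr fun m => ?_
    show C₉ * D * (((m / N : ℕ) : ℝ) * q ^ (m / N)) = _
    ring

/-- **GROWING MODULI ⇒ NODE U6 (clause N2 idle).**  Under the hypotheses of `summable_majorant_growing`, every injection dominated by the
majorant of `bracket_le_of_growing` has `Summable (T4CauchySum.delta E ρ inj)`.  Read with the recursion's moduli `ℓ(ω+c)^{m−1−i}` of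
`T4HistoryLipschitzRecursion.ne9_and_fadingMemory_of_geometricStep` (which needs NO smallness for NE9 itself): GIVEN tower-NE5 and node
U2's geometric matching, node U3 → U6 closes for ANY finite `ω + c` — the record's clause N2 `ω + c < 1` is not used. [folklore] -/
theorem summable_delta_of_growing {C₅ θ C₉ D q : ℝ} (hC : 0 ≤ C₅) (hθ0 : 0 ≤ θ) (hθ1 : θ < 1) (hC9 : 0 ≤ C₉) (hD : 0 ≤ D)
    (hq0 : 0 ≤ q) (hq1 : q < 1) {N : ℕ} (hN : 1 ≤ N)
    {E ρ : ℝ} (hE : 0 ≤ E) (hρ : 0 ≤ ρ) (hρ1 : ρ < 1) {inj : ℕ → ℕ → ℝ}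
    (hinj : ∀ K j : ℕ, j ≤ K → 0 ≤ inj K j ∧
      inj K j ≤ 2 * C₅ * θ ^ (j / N) / (1 - θ) + C₉ * D * (j / N : ℕ) * q ^ (j / N)) :
    Summable (delta E ρ inj) :=
  summable_delta_of_scaleProfile hE hρ hρ1
    (fun j => add_nonneg
      (div_nonneg (mul_nonneg (mul_nonneg (by norm_num) hC) (pow_nonneg hθ0 _)) (by linarith))
      (mul_nonneg (mul_nonneg (mul_nonneg hC9 hD) (Nat.cast_nonneg _)) (pow_nonneg hq0 _)))
    (summable_majorant_growing hθ0 hθ1 hq0 hq1 hN) hinj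

/-! ## §4 The dictionary: the window of record is shift- and hybrid-closed; two-run NE5 with the unpaired coupling as a parameter IS the
one-drop oscillation statement -/

/-- `T4OutputRate.Window γ` is closed under dropping the oldest coupling. [folklore] -/
theorem shift_mem_window {γ : ℝ} {g : ℕ → ℝ} (hg : g ∈ Window γ) : (fun i => g (i + 1)) ∈ Window γ :=
  fun i => hg (i + 1)
/-- `T4OutputRate.Window γ` is closed under hybrids (old block of one history, young block of another). [folklore] -/
theorem mix_mem_window {γ : ℝ} {g g' : ℕ → ℝ} (hg : g ∈ Window γ) (hg' : g' ∈ Window γ) (a : ℕ) :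
    (fun i => if i < a then g' i else g i) ∈ Window γ := by
  intro i
  by_cases hi : i < a
  · simpa [hi] using hg' i
  · simpa [hi] using hg i

/-- **TWO CONSECUTIVE LEVELS ON THE CARRIERS OF RECORD.**  If run B's functional with its unpaired bare coupling `b` as a parameter satisfies
`NE5 EA (EB b) W κ θ C₅` for every admissible `b` (the form in which node U2's read-out consumes NE5), then run B's scale-`j` term
OSCILLATES in that coupling by at most `2C₅θ^j·e^{−κd_j(X)}`: the `a = 1` case of §1, with the background transport explicit. [folklore] -/
theorem osc_unpaired_of_ne5 {C : Carriers} {EA : Functional C C.BgA} {EB : ℝ → Functional C C.BgB} {W : Set (ℕ → ℝ)}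
    {S : Set ℝ} {κ θ C₅ : ℝ} (h5 : ∀ b ∈ S, NE5 EA (EB b) W κ θ C₅)
    {b b' : ℝ} (hb : b ∈ S) (hb' : b' ∈ S) {g : ℕ → ℝ} (hg : g ∈ W) (U : C.BgB) (X : C.Dom) :
    |EB b g U X - EB b' g U X| ≤ 2 * C₅ * θ ^ C.scale X * Real.exp (-(κ * C.d X)) := by
  have h1 := h5 b hb g hg U X
  have h2 := h5 b' hb' g hg U X
  rw [abs_sub_comm] at h1
  have t := abs_sub_le (EB b g U X) (EA g (C.transport U) X) (EB b' g U X)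
  linarith
end Summit.QuantumFields.BalabanUV.T4Continuum.NE9.MemoryFromRate
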